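import Summits.QuantumFields.YangMills.Theorems.BalabanLadderUVSeamRecPolymerCarrierFolding
import Summits.QuantumFields.YangMills.Theorems.BalabanLadderUVSeamRecResponseMomentsDefs
import HarnessLib

/-!
# Crux `UVSeamRec` (stmt-QuantumFields-20043), v5(α) stub `stub_responseMomentsOdd6` (RM): the POLYMER DATA of the tempered
# architecture, V — the LEVEL-ZERO large-field carrier has β-uniformly bounded doubled joint exponential moments on EVERY odd
# torus (unconditional), so at level `0` the (β) architecture needs only the quadratic-carrier inputs

Helper file (`--supports stmt-QuantumFields-20043 --as helper`) of the unit `ym-20043-tempered-d1` (gen 1); sequel of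
`…PolymerCarrier.lean` (uniform bounds, glue `responseMoments_of_quadratic_and_influence`), of `…PolymerCarrierFolding.lean` (folding of the
level-`0` polymer system onto the torus, `sum_foldCoeff_zero_le_one`, `torusLift_mem_largeFieldEvent_zero_iff_cost`), of g0's
`…PolymerDataLevelZero.lean` (p534572: at level `0` the chart returns the plain plaquette) and of ceilings-p2's scale-zero supplier
p530009 `…CeilingsPolymerRarityPlaquetteScale.lean` (`PolymerRarity.torusE_prod_indicator_largePlaquetteZd_le`: the large plaquettes of the
Wilson state on every odd torus form a Peierls gas) and carriers press-button p535725 (`TemperedResponse.torusE_exp_two_mul_sum_le_of_polymerLaw`).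

WHAT.  The hypothesis (EM_I) of `responseMoments_of_quadratic_and_influence` — doubled joint exponential moments
`⟨exp(2 Σ_{i∈T} I_i∘lift)⟩_{2L+1,β} ≤ e^{B_I·#T}` of the influence functionals of a cyclically separated cube family — is PROVED at level
cutoff `kmax = 0` on every odd torus `(ℤ/(2L+1))⁴`, `4R+8 ≤ L`, `β ≥ 1`, with the explicit, asymptotically free constant
`B_I = 2e²·1536·δ(β)`, `δ(β) = exp(−βNε₀/6 + (K₀ + D₁ log β)/6)` (`torusE_exp_two_mul_sum_influence_zero_le`).  The proof FOLDS D1's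
level-`0` polymer system (plaquettes of `ℤ⁴` in the shells of the cubes) onto the torus: polymer index = plaquettes based in the
fundamental box `[−L, L]⁴` (representatives `valMinAbs`), events = ceilings-p2's large-plaquette events, coefficients = the shell
coefficients summed over the fibres of the folding; then (i) domination is an identity (periodicity of the lift), (ii) the Λ-budget
`Σ_i c_{iq} ≤ 1` is g0's `sum_familyCoeff_le_one` after translating each cube by a period (a fibre has at most one polymer per shell since
`4R+4 < 2L+1`), (iii) the density budget is `coeffMass_zero_le` (`W = 1536·δ`), (iv) the product law is p530009's.  Consequences:
`exists_expMoment_influence_zero` (a β-UNIFORM `B_I` once the level-`0` thresholds are bounded below by `ε₀ > 0`) and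
`exists_expMoment_influence_zero_small` (`B_I = η`, ANY `η > 0`, for `β ≥ β_I(η)`: the level-`0` large-field half is asymptotically free),
**`responseMoments_of_quadratic_levelZero`** — (split) with `LF :=` the level-`0` influence + (EM_Q) for the quadratic carrier ALONE ⇒ (RM) —
`momentBounds6_of_quadratic_levelZero`, and the BY-NAME form at `SU(2)`, fundamental, window to the unit of record:
**`responseMomentsOdd6SU2_of_quadratic_levelZero : … → ResponseMomentsOdd6SU2`** (p536324's name of the registered stub body).
HONEST FRAMING: the level-`0` large-field half of the (β) architecture is bookkeeping + the tree's plaquette-scale Peierls bound; the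
remaining inputs — the background-field split against `A₀ + Q + I⁽⁰⁾` for EVERY exterior and the Gaussian domination (EM_Q) of the quadratic
boundary-flux carrier — are OPEN renormalisation-group statements (whether level-`0` tempering suffices in the split is part of that open
question: block-scale coherent flux must then be carried by `Q`); nothing of E0′ is claimed; not a gap, not Clay.
References: folklore; J. Fröhlich, R. Israel, E. H. Lieb, B. Simon, Commun. Math. Phys. 62 (1978) §5 (chessboard Peierls bound, via
p530009); H.-O. Georgii, *Gibbs Measures and Phase Transitions* (2011) Thm. 4.17 (DLR part, via p532025).
-/

set_option autoImplicit false

noncomputable section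

open MeasureTheory Filter Topology Finset
open Literature.Probability.LatticeModels (box mem_box Torus.proj)
open Literature.MathematicalPhysics.QuantumFieldTheory (GaugeConfig LatticeRep plaquetteCost plaquetteHolonomy)
open Literature.MathematicalPhysics.QuantumLattice (LGConfig torusLift ZdPlaquette plaquetteObs fundamentalLatticeRep measurable_plaquetteObs)
open Summit.QuantumFields.YangMills.Cruxes.OSLegsFromFemtoAndGap.DlrCollarTransfer
open Summit.QuantumFields.YangMills.Cruxes.UVSeamRec.TemperedResponse (torusE_exp_two_mul_sum_le_of_polymerLaw momentBounds6_of_responseMoments)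
open Summit.QuantumFields.YangMills.Cruxes.UVSeamRec.PolymerRarity (torusE_prod_indicator_largePlaquetteZd_le indicator_largePlaquetteZd_torusLift)

namespace Summit.QuantumFields.YangMills.Cruxes.UVSeamRec.PolymerData

/-! ## §1 The level-`0` influence functionals have doubled joint exponential moments `≤ exp(2e²·1536·δ(β)·#T)` on every odd torus -/

section LevelZero

variable (N : ℕ) [NeZero N]

/-- **(EM_I) AT LEVEL `0`, UNCONDITIONALLY, ON EVERY ODD TORUS.**  There are constants `K₀, D₁` (ceilings-p2's Peierls constants of the
fundamental Wilson state of `SU(N)`, p530009) such that for every block size `𝔟`, thresholds `ε` (only `ε 0` matters), `β ≥ 1`, every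
odd torus `(ℤ/(2L+1))⁴` and cube family `x` pairwise cyclically `2R+4`-separated with `1 ≤ R`, `4R+8 ≤ L`, and every index set `T`:
`⟨exp(2 Σ_{i∈T} influence 𝔟 ε 0 R (x i)∘lift)⟩_{2L+1,β} ≤ exp(2e²·1536·δ·#T)`, `δ = exp(−βNε₀/6 + (K₀ + D₁ log β)/6)`, `ε₀ = ε 0` — the
level-`0` large-field correction of the (β) architecture has β-uniformly (indeed asymptotically freely) bounded doubled joint exponential
moments.  Proof: fold the level-`0` polymer system onto the plaquettes based in `[−L, L]⁴` (§§1–2) and apply ceilings-p2's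
`torusE_exp_two_mul_sum_le_of_polymerLaw` (Λ = 1, `W = 1536·δ`) with the product law `torusE_prod_indicator_largePlaquetteZd_le`.
[folklore: Fröhlich–Israel–Lieb–Simon (1978) §5 for the Peierls input] -/
theorem torusE_exp_two_mul_sum_influence_zero_le :
    ∃ K₀ : ℝ, ∃ D₁ : ℕ, ∀ (𝔟 : BlockSize) (ε : ℕ → ℝ) (β : ℝ), 1 ≤ β →
      ∀ (L n : ℕ) (x : Fin n → (Fin 4 → ℤ)) (R : ℕ), 1 ≤ R → 4 * R + 8 ≤ L →
      (∀ i j : Fin n, i ≠ j → ∃ k : Fin 4,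
        (2 * (R : ℤ) + 4) ≤ |((((x i k - x j k : ℤ) : ZMod (2 * L + 1))).valMinAbs : ℤ)|) →
      ∀ T : Finset (Fin n),
        torusE (Matrix.specialUnitaryGroup (Fin N) ℂ) (fundamentalLatticeRep N) β L
          (fun U => Real.exp (((2 : ℕ) : ℝ) * ∑ i ∈ T, influence (N := N) 𝔟 ε 0 R (x i) U)) ≤
          Real.exp (2 * Real.exp 2 *
            (1536 * Real.exp (-(β * (N * ε 0)) / 6 + (K₀ + D₁ * Real.log β) / 6)) * T.card) := by
  classical
  obtain ⟨K₀, D₁, hPL0⟩ := torusE_prod_indicator_largePlaquetteZd_le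
    (G := Matrix.specialUnitaryGroup (Fin N) ℂ) (fundamentalLatticeRep N)
  have hor : Fintype.card (Summit.QuantumFields.YangMills.Theorems.OddTorusChessboard.Orient 4) = 6 := by decide
  refine ⟨K₀, D₁, ?_⟩
  intro 𝔟 ε β hβ L n x R hR hRL hsep T
  haveI : SecondCountableTopology (Matrix.specialUnitaryGroup (Fin N) ℂ) :=
    ((fundamentalLatticeRep N).continuous.isClosedEmbedding
      (fundamentalLatticeRep N).injective).isEmbedding.secondCountableTopology
  -- the folded polymer system
  set δ : ℝ := Real.exp (-(β * (N * ε 0)) / 6 + (K₀ + D₁ * Real.log β) / 6) with hδ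
  set S : Finset (ZdPlaquette 4) := (box 4 L) ×ˢ (Finset.univ : Finset {p : Fin 4 × Fin 4 // p.1 < p.2}) with hS
  set E : ZdPlaquette 4 → Set (LGConfig 4 (Matrix.specialUnitaryGroup (Fin N) ℂ)) := fun q =>
    {η | (N : ℝ) * ε 0 ≤ ((fundamentalLatticeRep N).N : ℝ) -
      plaquetteObs (fundamentalLatticeRep N).ρ q.1 q.2.1.1 q.2.1.2 η} with hE
  set fold : Polymer → ZdPlaquette 4 := fun γ =>
    ((fun j => ((((γ.y j : ℤ) : ZMod (2 * L + 1))).valMinAbs : ℤ)),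
      (⟨(γ.μ, γ.ν), γ.hμν⟩ : {p : Fin 4 × Fin 4 // p.1 < p.2})) with hfold
  set c : Fin n → ZdPlaquette 4 → ℝ := fun i q =>
    ∑ γ ∈ (shell 𝔟 0 R (x i)).filter (fun γ => fold γ = q), influenceCoeff 𝔟 γ (x i) with hc
  -- folding lands in `S`
  have hmaps : ∀ i, ∀ γ ∈ shell 𝔟 0 R (x i), fold γ ∈ S := by
    intro i γ _
    rw [hS, Finset.mem_product]
    exact ⟨valMinAbs_mem_box L γ.y, Finset.mem_univ _⟩
  -- the lifted level-0 event of `γ` is ceilings-p2's torus event of `fold γ`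
  have hevent : ∀ i, ∀ γ ∈ shell 𝔟 0 R (x i), ∀ U : GaugeConfig 4 (2 * L + 1) (Matrix.specialUnitaryGroup (Fin N) ℂ),
      (largeFieldEvent (N := N) 𝔟 (ε γ.k) γ).indicator (fun _ => (1 : ℝ)) (torusLift (2 * L + 1) U) =
        (E (fold γ)).indicator (fun _ => (1 : ℝ)) (torusLift (2 * L + 1) U) := by
    intro i γ hγ U
    obtain ⟨k, y, μ, ν, h⟩ := γ
    have hk : k = 0 := Nat.le_zero.1 (level_le_of_mem_shell hγ)
    subst hk
    have hR : (E (fold ⟨0, y, μ, ν, h⟩)).indicator (fun _ => (1 : ℝ)) (torusLift (2 * L + 1) U) =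
        {V : GaugeConfig 4 (2 * L + 1) (Matrix.specialUnitaryGroup (Fin N) ℂ) | (N : ℝ) * ε 0 ≤
          plaquetteCost (fundamentalLatticeRep N).ρ V
            (Torus.proj (2 * L + 1) (fun j => ((((y j : ℤ) : ZMod (2 * L + 1))).valMinAbs : ℤ)), ⟨(μ, ν), h⟩)}.indicator
          (fun _ => (1 : ℝ)) U :=
      indicator_largePlaquetteZd_torusLift (fundamentalLatticeRep N) (2 * L + 1) ((N : ℝ) * ε 0) (fold ⟨0, y, μ, ν, h⟩) U
    rw [hR, proj_valMinAbs]
    simp only [Set.indicator_apply, Set.mem_setOf_eq, torusLift_mem_largeFieldEvent_zero_iff_cost]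
  -- (i) domination, as an identity
  have hdom : ∀ (i : Fin n) (U : GaugeConfig 4 (2 * L + 1) (Matrix.specialUnitaryGroup (Fin N) ℂ)),
      influence (N := N) 𝔟 ε 0 R (x i) (torusLift (2 * L + 1) U) ≤
        ∑ q ∈ S, c i q * (E q).indicator (fun _ => (1 : ℝ)) (torusLift (2 * L + 1) U) := by
    intro i U
    refine le_of_eq ?_
    rw [influence, Finset.sum_congr rfl fun γ hγ => by rw [hevent i γ hγ U]]
    rw [← Finset.sum_fiberwise_of_maps_to (hmaps i)
      (f := fun γ => influenceCoeff 𝔟 γ (x i) * (E (fold γ)).indicator (fun _ => (1 : ℝ)) (torusLift (2 * L + 1) U))]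
    refine Finset.sum_congr rfl fun q _ => ?_
    rw [hc, Finset.sum_mul]
    refine Finset.sum_congr rfl fun γ hγ => ?_
    rw [(Finset.mem_filter.1 hγ).2]
  -- (ii) the Λ-budget, Λ = 1
  have hΛ : ∀ q ∈ S, ∑ i, c i q ≤ (1 : ℝ) := by
    intro q _
    have h := sum_foldCoeff_zero_le_one 𝔟 hRL x hsep q
    simpa only [hc, hfold] using h
  -- (iii) the density budget, W = 1536·δ
  have hW : ∀ i, ∑ q ∈ S, c i q * δ ≤ 1536 * δ := by
    intro i
    rw [← Finset.sum_mul]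
    refine mul_le_mul_of_nonneg_right ?_ (by rw [hδ]; exact (Real.exp_pos _).le)
    calc ∑ q ∈ S, c i q = ∑ γ ∈ shell 𝔟 0 R (x i), influenceCoeff 𝔟 γ (x i) := by
          rw [hc]
          exact Finset.sum_fiberwise_of_maps_to (hmaps i) _
      _ ≤ 1536 := coeffMass_zero_le 𝔟 R (x i)
  -- (iv) the product law: ceilings-p2's Peierls gas of large plaquettes, read in the box
  have hPL : ∀ A, A ⊆ S →
      torusE (Matrix.specialUnitaryGroup (Fin N) ℂ) (fundamentalLatticeRep N) β L
        (fun U => ∏ q ∈ A, (E q).indicator (fun _ => (1 : ℝ)) U) ≤ ∏ _q ∈ A, δ := by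
    intro A hA
    have hbox : ∀ q ∈ A, q.1 ∈ box 4 L := fun q hq => (Finset.mem_product.1 (hA hq)).1
    have h := hPL0 L (by omega) β hβ ((N : ℝ) * ε 0) A hbox
    rw [hor] at h
    simpa only [hE, hδ, Nat.cast_ofNat, neg_div, mul_assoc] using h
  have hEm : ∀ q, MeasurableSet (E q) := fun q =>
    measurableSet_le measurable_const (measurable_const.sub
      (measurable_plaquetteObs (fundamentalLatticeRep N).ρ (fundamentalLatticeRep N).continuous _ _ _))
  have hw : ∀ q ∈ S, (0 : ℝ) ≤ δ := fun _ _ => by rw [hδ]; exact (Real.exp_pos _).le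
  have hcnn : ∀ i, ∀ q ∈ S, 0 ≤ c i q := fun i q _ => by
    rw [hc]
    exact Finset.sum_nonneg fun γ _ => influenceCoeff_nonneg 𝔟 γ (x i)
  have key := torusE_exp_two_mul_sum_le_of_polymerLaw (G := Matrix.specialUnitaryGroup (Fin N) ℂ)
    (fundamentalLatticeRep N) β L (fun i => influence (N := N) 𝔟 ε 0 R (x i)) S E (fun _ => δ) c hEm hw hcnn
    hdom hΛ hW hPL T
  rw [show (2 : ℝ) * 1 = 2 by norm_num] at key
  exact key

/-- **A β-UNIFORM constant for the level-`0` large-field half.**  If the level-`0` thresholds are bounded below, `ε β 0 ≥ ε₀ > 0`, then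
ONE constant `B_I ≥ 0` bounds the doubled joint exponential moments of the level-`0` influence functionals for all `β ≥ 1`, all odd tori
and all separated families — hypothesis (EM_I) of `responseMoments_of_quadratic_and_influence` at `kmax = 0`, DISCHARGED.  (`δ(β) ≤
exp((K₀ − D₁(1 + log(Nε₀/(D₁+1))))/6)` since `D₁ log β ≤ βNε₀ − D₁(1 + log(Nε₀/(D₁+1)))`.) [folklore] -/
theorem exists_expMoment_influence_zero (𝔟 : BlockSize) {ε₀ : ℝ} (hε₀ : 0 < ε₀) :
    ∃ B_I : ℝ, 0 ≤ B_I ∧ ∀ (ε : ℝ → ℕ → ℝ), (∀ β, ε₀ ≤ ε β 0) → ∀ β : ℝ, 1 ≤ β →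
      ∀ (L n : ℕ) (q : Fin n → Fin 4 × Fin 4) (x : Fin n → (Fin 4 → ℤ)) (R : ℕ), 1 ≤ R → 4 * R + 8 ≤ L →
      (∀ i j : Fin n, i ≠ j → ∃ k : Fin 4,
        (2 * (R : ℤ) + 4) ≤ |((((x i k - x j k : ℤ) : ZMod (2 * L + 1))).valMinAbs : ℤ)|) →
      ∀ T : Finset (Fin n),
        torusE (Matrix.specialUnitaryGroup (Fin N) ℂ) (fundamentalLatticeRep N) β L
          (fun U => Real.exp (((2 : ℕ) : ℝ) * ∑ i ∈ T, influenceAt (N := N) 𝔟 ε (fun _ _ => 0) β R (q i) (x i) U)) ≤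
          Real.exp (B_I * T.card) := by
  obtain ⟨K₀, D₁, h⟩ := torusE_exp_two_mul_sum_influence_zero_le N
  have hN : (0 : ℝ) < N := by exact_mod_cast Nat.pos_of_ne_zero (NeZero.ne N)
  set c' : ℝ := N * ε₀ / (D₁ + 1) with hc'
  have hc'pos : 0 < c' := by rw [hc']; positivity
  set M : ℝ := -(D₁ : ℝ) * (1 + Real.log c') with hM
  set B_I : ℝ := 2 * Real.exp 2 * (1536 * Real.exp ((K₀ + M) / 6)) with hB
  refine ⟨B_I, by rw [hB]; positivity, ?_⟩
  intro ε hε β hβ L n q x R hR hRL hsep T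
  have hβ0 : 0 < β := by linarith
  -- `−βN(ε β 0) + D₁ log β ≤ M`
  have hexp : -(β * (N * ε β 0)) / 6 + (K₀ + D₁ * Real.log β) / 6 ≤ (K₀ + M) / 6 := by
    have h1 : β * (N * ε₀) ≤ β * (N * ε β 0) :=
      mul_le_mul_of_nonneg_left (mul_le_mul_of_nonneg_left (hε β) hN.le) hβ0.le
    have hlog : Real.log β ≤ β * c' - 1 - Real.log c' := by
      have h2 := Real.log_le_sub_one_of_pos (mul_pos hβ0 hc'pos)
      rw [Real.log_mul hβ0.ne' hc'pos.ne'] at h2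
      linarith
    have hD : (0 : ℝ) ≤ D₁ := Nat.cast_nonneg _
    have h3 : (D₁ : ℝ) * Real.log β ≤ D₁ * (β * c' - 1 - Real.log c') := mul_le_mul_of_nonneg_left hlog hD
    have h4 : (D₁ : ℝ) * (β * c') ≤ β * (N * ε₀) := by
      rw [hc']
      have : (D₁ : ℝ) * (β * (N * ε₀ / (D₁ + 1))) = β * (N * ε₀) * (D₁ / (D₁ + 1)) := by ring
      rw [this]
      have h5 : (D₁ : ℝ) / (D₁ + 1) ≤ 1 := by
        rw [div_le_one (by positivity)]; linarith
      have h6 : 0 ≤ β * (N * ε₀) := by positivity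
      nlinarith
    rw [hM]
    nlinarith
  calc torusE (Matrix.specialUnitaryGroup (Fin N) ℂ) (fundamentalLatticeRep N) β L
        (fun U => Real.exp (((2 : ℕ) : ℝ) * ∑ i ∈ T, influenceAt (N := N) 𝔟 ε (fun _ _ => 0) β R (q i) (x i) U))
      = torusE (Matrix.specialUnitaryGroup (Fin N) ℂ) (fundamentalLatticeRep N) β L
        (fun U => Real.exp (((2 : ℕ) : ℝ) * ∑ i ∈ T, influence (N := N) 𝔟 (ε β) 0 R (x i) U)) := rfl
    _ ≤ Real.exp (2 * Real.exp 2 *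
            (1536 * Real.exp (-(β * (N * ε β 0)) / 6 + (K₀ + D₁ * Real.log β) / 6)) * T.card) :=
        h 𝔟 (ε β) β hβ L n x R hR hRL hsep T
    _ ≤ Real.exp (B_I * T.card) := by
        rw [hB]
        refine Real.exp_le_exp.2 (mul_le_mul_of_nonneg_right ?_ (Nat.cast_nonneg _))
        refine mul_le_mul_of_nonneg_left (mul_le_mul_of_nonneg_left (Real.exp_le_exp.2 hexp) (by norm_num)) ?_
        positivity

/-- **… and an ARBITRARILY SMALL one at weak coupling (asymptotic freedom of the level-`0` large-field half).**  For every `η > 0`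
there is `β_I ≥ 1` such that for `β ≥ β_I` the doubled joint exponential moments of the level-`0` influence functionals are
`≤ exp(η·#T)` on every odd torus and separated family: `δ(β) = exp(−βNε₀/6 + (K₀ + D₁ log β)/6) → 0`, quantitatively
`D₁ log β ≤ βNε₀/2 − D₁(1 + log(Nε₀/(2(D₁+1))))`.  So in `responseMoments_of_quadratic_and_influence` at `kmax = 0` the large-field
carrier costs `B_I = η` of the exponent budget, any `η > 0`, after raising `β₁`. [folklore] -/
theorem exists_expMoment_influence_zero_small (𝔟 : BlockSize) {ε₀ : ℝ} (hε₀ : 0 < ε₀) {η : ℝ} (hη : 0 < η) :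
    ∃ β_I : ℝ, 1 ≤ β_I ∧ ∀ (ε : ℝ → ℕ → ℝ), (∀ β, ε₀ ≤ ε β 0) → ∀ β : ℝ, β_I ≤ β →
      ∀ (L n : ℕ) (q : Fin n → Fin 4 × Fin 4) (x : Fin n → (Fin 4 → ℤ)) (R : ℕ), 1 ≤ R → 4 * R + 8 ≤ L →
      (∀ i j : Fin n, i ≠ j → ∃ k : Fin 4,
        (2 * (R : ℤ) + 4) ≤ |((((x i k - x j k : ℤ) : ZMod (2 * L + 1))).valMinAbs : ℤ)|) →
      ∀ T : Finset (Fin n),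
        torusE (Matrix.specialUnitaryGroup (Fin N) ℂ) (fundamentalLatticeRep N) β L
          (fun U => Real.exp (((2 : ℕ) : ℝ) * ∑ i ∈ T, influenceAt (N := N) 𝔟 ε (fun _ _ => 0) β R (q i) (x i) U)) ≤
          Real.exp (η * T.card) := by
  obtain ⟨K₀, D₁, h⟩ := torusE_exp_two_mul_sum_influence_zero_le N
  have hN : (0 : ℝ) < N := by exact_mod_cast Nat.pos_of_ne_zero (NeZero.ne N)
  set c' : ℝ := N * ε₀ / (2 * (D₁ + 1)) with hc'
  have hc'pos : 0 < c' := by rw [hc']; positivity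
  set A : ℝ := K₀ - (D₁ : ℝ) * (1 + Real.log c') with hA
  set β_I : ℝ := max 1 (2 * (A - 6 * Real.log (η / (2 * Real.exp 2 * 1536))) / (N * ε₀)) with hβI
  refine ⟨β_I, le_max_left _ _, ?_⟩
  intro ε hε β hβ L n q x R hR hRL hsep T
  have hβ1 : 1 ≤ β := (le_max_left _ _).trans hβ
  have hβ0 : 0 < β := by linarith
  have hNε : 0 < N * ε₀ := by positivity
  -- the exponent of `δ(β)` is `≤ (−βNε₀/2 + A)/6`
  have hexp : -(β * (N * ε β 0)) / 6 + (K₀ + D₁ * Real.log β) / 6 ≤ (-(β * (N * ε₀)) / 2 + A) / 6 := by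
    have h1 : β * (N * ε₀) ≤ β * (N * ε β 0) :=
      mul_le_mul_of_nonneg_left (mul_le_mul_of_nonneg_left (hε β) hN.le) hβ0.le
    have hlog : Real.log β ≤ β * c' - 1 - Real.log c' := by
      have h2 := Real.log_le_sub_one_of_pos (mul_pos hβ0 hc'pos)
      rw [Real.log_mul hβ0.ne' hc'pos.ne'] at h2
      linarith
    have hD : (0 : ℝ) ≤ D₁ := Nat.cast_nonneg _
    have h3 : (D₁ : ℝ) * Real.log β ≤ D₁ * (β * c' - 1 - Real.log c') := mul_le_mul_of_nonneg_left hlog hD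
    have h4 : (D₁ : ℝ) * (β * c') ≤ β * (N * ε₀) / 2 := by
      rw [hc']
      have : (D₁ : ℝ) * (β * (N * ε₀ / (2 * (D₁ + 1)))) = β * (N * ε₀) / 2 * (D₁ / (D₁ + 1)) := by
        field_simp
      rw [this]
      have h5 : (D₁ : ℝ) / (D₁ + 1) ≤ 1 := by
        rw [div_le_one (by positivity)]; linarith
      have h6 : 0 ≤ β * (N * ε₀) / 2 := by positivity
      nlinarith
    rw [hA]
    nlinarith
  -- from `β ≥ β_I`: `(−βNε₀/2 + A)/6 ≤ log(η/(2e²·1536))`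
  have htarget : (-(β * (N * ε₀)) / 2 + A) / 6 ≤ Real.log (η / (2 * Real.exp 2 * 1536)) := by
    have hβ' : 2 * (A - 6 * Real.log (η / (2 * Real.exp 2 * 1536))) / (N * ε₀) ≤ β := (le_max_right _ _).trans hβ
    rw [div_le_iff₀ hNε] at hβ'
    nlinarith
  have hpos : (0 : ℝ) < 2 * Real.exp 2 * 1536 := by positivity
  calc torusE (Matrix.specialUnitaryGroup (Fin N) ℂ) (fundamentalLatticeRep N) β L
        (fun U => Real.exp (((2 : ℕ) : ℝ) * ∑ i ∈ T, influenceAt (N := N) 𝔟 ε (fun _ _ => 0) β R (q i) (x i) U))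
      = torusE (Matrix.specialUnitaryGroup (Fin N) ℂ) (fundamentalLatticeRep N) β L
        (fun U => Real.exp (((2 : ℕ) : ℝ) * ∑ i ∈ T, influence (N := N) 𝔟 (ε β) 0 R (x i) U)) := rfl
    _ ≤ Real.exp (2 * Real.exp 2 *
            (1536 * Real.exp (-(β * (N * ε β 0)) / 6 + (K₀ + D₁ * Real.log β) / 6)) * T.card) :=
        h 𝔟 (ε β) β hβ1 L n x R hR hRL hsep T
    _ ≤ Real.exp (η * T.card) := by
        refine Real.exp_le_exp.2 (mul_le_mul_of_nonneg_right ?_ (Nat.cast_nonneg _))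
        have hδ : Real.exp (-(β * (N * ε β 0)) / 6 + (K₀ + D₁ * Real.log β) / 6) ≤ η / (2 * Real.exp 2 * 1536) := by
          calc Real.exp (-(β * (N * ε β 0)) / 6 + (K₀ + D₁ * Real.log β) / 6)
              ≤ Real.exp (Real.log (η / (2 * Real.exp 2 * 1536))) := Real.exp_le_exp.2 (hexp.trans htarget)
            _ = η / (2 * Real.exp 2 * 1536) := Real.exp_log (by positivity)
        calc 2 * Real.exp 2 * (1536 * Real.exp (-(β * (N * ε β 0)) / 6 + (K₀ + D₁ * Real.log β) / 6))
            ≤ 2 * Real.exp 2 * (1536 * (η / (2 * Real.exp 2 * 1536))) := by gcongr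
          _ = η := by field_simp

end LevelZero

/-! ## §2 (RM) at level `0`: only the quadratic-carrier inputs remain -/

section Consequences

variable (N : ℕ) [NeZero N] (a : ℝ → ℝ)

/-- **(RM) FROM THE LEVEL-`0` (β) ARCHITECTURE — two open inputs, both about the quadratic carrier.**  Data: the quadratic carrier `Q`
(`|Q| ≤ MQ β R`, measurable), tempering data `𝔟`, thresholds `ε` with `ε β 0 ≥ ε₀ > 0`, constants `C₁, A₀, B_Q, β₁ ≥ 1, ℓ₁`, reference
values `p`; the torus state and the kernels in the FUNDAMENTAL representation of `SU(N)`.  Hypotheses: (split) for `β ≥ β₁`, femto radii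
`R·a β ≤ ℓ₁` and EVERY exterior, `(R⁴/C₁)|kerE(plane)(η) − p| ≤ A₀ + Q(η) + I⁽⁰⁾(η)` with `I⁽⁰⁾ = influenceAt 𝔟 ε 0` the LEVEL-`0` influence of
the shell; (EM_Q) doubled joint exponential moments of `Q` on every odd torus.  THEN (RM) holds (body of p532025's `hRM`, some β-uniform
`B`).  The large-field half is `exists_expMoment_influence_zero`. [folklore] -/
theorem responseMoments_of_quadratic_levelZero {C₁ β₁ ℓ₁ A₀ B_Q ε₀ : ℝ} {p : Fin 4 × Fin 4 → ℝ → ℝ}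
    (Q : ℝ → ℕ → Fin 4 × Fin 4 → (Fin 4 → ℤ) → LGConfig 4 (Matrix.specialUnitaryGroup (Fin N) ℂ) → ℝ) (MQ : ℝ → ℕ → ℝ)
    (hQm : ∀ β R q x, Measurable (Q β R q x)) (hQb : ∀ β R q x η, |Q β R q x η| ≤ MQ β R)
    (𝔟 : BlockSize) (ε : ℝ → ℕ → ℝ) (hε₀ : 0 < ε₀) (hε : ∀ β, ε₀ ≤ ε β 0) (hβ₁ : 1 ≤ β₁)
    (hsplit : ∀ β : ℝ, β₁ ≤ β → ∀ R : ℕ, 1 ≤ R → (R : ℝ) * a β ≤ ℓ₁ →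
      ∀ (q : Fin 4 × Fin 4) (x : Fin 4 → ℤ), q.1 < q.2 → ∀ η : LGConfig 4 (Matrix.specialUnitaryGroup (Fin N) ℂ),
        (R : ℝ) ^ 4 / C₁ * |kerE (Matrix.specialUnitaryGroup (Fin N) ℂ) (fundamentalLatticeRep N) β
          (fun k => x k - (R + 1)) (2 * R + 3) η (plane (Matrix.specialUnitaryGroup (Fin N) ℂ) (fundamentalLatticeRep N) q x) -
          p q β| ≤ A₀ + Q β R q x η + influenceAt (N := N) 𝔟 ε (fun _ _ => 0) β R q x η)
    (hEMQ : ∀ β : ℝ, β₁ ≤ β → ∀ (L n : ℕ) (q : Fin n → Fin 4 × Fin 4) (x : Fin n → (Fin 4 → ℤ)) (R : ℕ),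
      (∀ i, (q i).1 < (q i).2) → 1 ≤ R → (R : ℝ) * a β ≤ ℓ₁ → 4 * R + 8 ≤ L →
      (∀ i j : Fin n, i ≠ j → ∃ k : Fin 4,
        (2 * (R : ℤ) + 4) ≤ |((((x i k - x j k : ℤ) : ZMod (2 * L + 1))).valMinAbs : ℤ)|) →
      ∀ T : Finset (Fin n),
        torusE (Matrix.specialUnitaryGroup (Fin N) ℂ) (fundamentalLatticeRep N) β L
          (fun U => Real.exp (((2 : ℕ) : ℝ) * ∑ i ∈ T, Q β R (q i) (x i) U)) ≤ Real.exp (B_Q * T.card)) :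
    ∃ B : ℝ, ∀ β : ℝ, β₁ ≤ β → ∀ (L n : ℕ) (q : Fin n → Fin 4 × Fin 4) (x : Fin n → (Fin 4 → ℤ)) (R : ℕ),
      (∀ i, (q i).1 < (q i).2) → 1 ≤ R → (R : ℝ) * a β ≤ ℓ₁ → 4 * R + 8 ≤ L →
      (∀ i j : Fin n, i ≠ j → ∃ k : Fin 4,
        (2 * (R : ℤ) + 4) ≤ |((((x i k - x j k : ℤ) : ZMod (2 * L + 1))).valMinAbs : ℤ)|) →
      ∀ T : Finset (Fin n),
        torusE (Matrix.specialUnitaryGroup (Fin N) ℂ) (fundamentalLatticeRep N) β L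
          (fun U => Real.exp (∑ i ∈ T, (R : ℝ) ^ 4 / C₁ *
            |kerE (Matrix.specialUnitaryGroup (Fin N) ℂ) (fundamentalLatticeRep N) β (fun k => x i k - (R + 1)) (2 * R + 3) U
              (plane (Matrix.specialUnitaryGroup (Fin N) ℂ) (fundamentalLatticeRep N) (q i) (x i)) - p (q i) β|)) ≤
          Real.exp (B * T.card) := by
  obtain ⟨B_I, _, hI⟩ := exists_expMoment_influence_zero N 𝔟 hε₀
  exact ⟨A₀ + max B_Q B_I, responseMoments_of_quadratic_and_influence (fundamentalLatticeRep N) a Q MQ hQm hQb 𝔟 ε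
    (fun _ _ => 0) hsplit hEMQ
    (fun β hβ L n q x R _ hR _ hRL hsep T => hI ε hε β (hβ₁.trans hβ) L n q x R hR hRL hsep T)⟩

/-- **`MomentBounds6 SU(N) rF a` from the level-`0` (β) architecture** (`rF` the fundamental representation) — the previous theorem ⊕
p532025 `momentBounds6_of_responseMoments`. [folklore: Georgii (2011) Thm. 4.17 for the DLR part] -/
theorem momentBounds6_of_quadratic_levelZero {C₁ β₁ ℓ₁ A₀ B_Q ε₀ P₀ : ℝ} {p : Fin 4 × Fin 4 → ℝ → ℝ}
    (hℓ₁ : 0 < ℓ₁) (hC₁ : 0 < C₁) (hp : ∀ q β, |p q β| ≤ P₀)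
    (Q : ℝ → ℕ → Fin 4 × Fin 4 → (Fin 4 → ℤ) → LGConfig 4 (Matrix.specialUnitaryGroup (Fin N) ℂ) → ℝ) (MQ : ℝ → ℕ → ℝ)
    (hQm : ∀ β R q x, Measurable (Q β R q x)) (hQb : ∀ β R q x η, |Q β R q x η| ≤ MQ β R)
    (𝔟 : BlockSize) (ε : ℝ → ℕ → ℝ) (hε₀ : 0 < ε₀) (hε : ∀ β, ε₀ ≤ ε β 0) (hβ₁ : 1 ≤ β₁)
    (hsplit : ∀ β : ℝ, β₁ ≤ β → ∀ R : ℕ, 1 ≤ R → (R : ℝ) * a β ≤ ℓ₁ →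
      ∀ (q : Fin 4 × Fin 4) (x : Fin 4 → ℤ), q.1 < q.2 → ∀ η : LGConfig 4 (Matrix.specialUnitaryGroup (Fin N) ℂ),
        (R : ℝ) ^ 4 / C₁ * |kerE (Matrix.specialUnitaryGroup (Fin N) ℂ) (fundamentalLatticeRep N) β
          (fun k => x k - (R + 1)) (2 * R + 3) η (plane (Matrix.specialUnitaryGroup (Fin N) ℂ) (fundamentalLatticeRep N) q x) -
          p q β| ≤ A₀ + Q β R q x η + influenceAt (N := N) 𝔟 ε (fun _ _ => 0) β R q x η)
    (hEMQ : ∀ β : ℝ, β₁ ≤ β → ∀ (L n : ℕ) (q : Fin n → Fin 4 × Fin 4) (x : Fin n → (Fin 4 → ℤ)) (R : ℕ),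
      (∀ i, (q i).1 < (q i).2) → 1 ≤ R → (R : ℝ) * a β ≤ ℓ₁ → 4 * R + 8 ≤ L →
      (∀ i j : Fin n, i ≠ j → ∃ k : Fin 4,
        (2 * (R : ℤ) + 4) ≤ |((((x i k - x j k : ℤ) : ZMod (2 * L + 1))).valMinAbs : ℤ)|) →
      ∀ T : Finset (Fin n),
        torusE (Matrix.specialUnitaryGroup (Fin N) ℂ) (fundamentalLatticeRep N) β L
          (fun U => Real.exp (((2 : ℕ) : ℝ) * ∑ i ∈ T, Q β R (q i) (x i) U)) ≤ Real.exp (B_Q * T.card)) :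
    MomentBounds6 (Matrix.specialUnitaryGroup (Fin N) ℂ) (fundamentalLatticeRep N) a := by
  obtain ⟨B, hB⟩ := responseMoments_of_quadratic_levelZero N a Q MQ hQm hQb 𝔟 ε hε₀ hε hβ₁ hsplit hEMQ
  exact momentBounds6_of_responseMoments (fundamentalLatticeRep N) a (B := B) hℓ₁ hC₁ hp hB

end Consequences

/-! ## §3 The by-name form at `SU(2)`, fundamental representation, window to the unit of record -/

section Named

/-- **THE LEVEL-`0` (β) ARCHITECTURE DELIVERS THE NAMED BINDER `ResponseMomentsOdd6SU2`** (p536324; = the body of the registered v5(α) stub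
`stub_responseMomentsOdd6`, `responseMomentsOdd6SU2_iff`).  For `SU(2)` in the fundamental representation, a unit `a ≤ c·uRec`
eventually (`c > 0`), a quadratic carrier `Q` with (split) against `A₀ + Q + I⁽⁰⁾` for every exterior and doubled joint exponential
moments (EM_Q) on every odd torus — the two OPEN inputs, owner R86g (2)'s `stub_temperedResponse6` (at level-`0` tempering) and
`stub_expMomentOdd6` (quadratic half) — the named (RM) follows; the level-`0` large-field half is a theorem of this file.  So at level `0`
the v6 split «(β) ⇒ (RM) PROVED in Theorems» (R86g (2)) holds with exactly two stub-shaped hypotheses. [folklore] -/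
theorem responseMomentsOdd6SU2_of_quadratic_levelZero {C₁ β₁ ℓ₁ A₀ B_Q ε₀ P₀ c : ℝ} {p : Fin 4 × Fin 4 → ℝ → ℝ}
    (a : ℝ → ℝ) (hc : 0 < c) (hwin : ∀ᶠ β in atTop, a β ≤ c * Transport.uRec β)
    (hℓ₁ : 0 < ℓ₁) (hC₁ : 0 < C₁) (hp : ∀ q β, |p q β| ≤ P₀)
    (Q : ℝ → ℕ → Fin 4 × Fin 4 → (Fin 4 → ℤ) → LGConfig 4 (Matrix.specialUnitaryGroup (Fin 2) ℂ) → ℝ) (MQ : ℝ → ℕ → ℝ)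
    (hQm : ∀ β R q x, Measurable (Q β R q x)) (hQb : ∀ β R q x η, |Q β R q x η| ≤ MQ β R)
    (𝔟 : BlockSize) (ε : ℝ → ℕ → ℝ) (hε₀ : 0 < ε₀) (hε : ∀ β, ε₀ ≤ ε β 0) (hβ₁ : 1 ≤ β₁)
    (hsplit : ∀ β : ℝ, β₁ ≤ β → ∀ R : ℕ, 1 ≤ R → (R : ℝ) * a β ≤ ℓ₁ →
      ∀ (q : Fin 4 × Fin 4) (x : Fin 4 → ℤ), q.1 < q.2 → ∀ η : LGConfig 4 (Matrix.specialUnitaryGroup (Fin 2) ℂ),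
        (R : ℝ) ^ 4 / C₁ * |kerE (Matrix.specialUnitaryGroup (Fin 2) ℂ) (fundamentalLatticeRep 2) β
          (fun k => x k - (R + 1)) (2 * R + 3) η (plane (Matrix.specialUnitaryGroup (Fin 2) ℂ) (fundamentalLatticeRep 2) q x) -
          p q β| ≤ A₀ + Q β R q x η + influenceAt (N := 2) 𝔟 ε (fun _ _ => 0) β R q x η)
    (hEMQ : ∀ β : ℝ, β₁ ≤ β → ∀ (L n : ℕ) (q : Fin n → Fin 4 × Fin 4) (x : Fin n → (Fin 4 → ℤ)) (R : ℕ),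
      (∀ i, (q i).1 < (q i).2) → 1 ≤ R → (R : ℝ) * a β ≤ ℓ₁ → 4 * R + 8 ≤ L →
      (∀ i j : Fin n, i ≠ j → ∃ k : Fin 4,
        (2 * (R : ℤ) + 4) ≤ |((((x i k - x j k : ℤ) : ZMod (2 * L + 1))).valMinAbs : ℤ)|) →
      ∀ T : Finset (Fin n),
        torusE (Matrix.specialUnitaryGroup (Fin 2) ℂ) (fundamentalLatticeRep 2) β L
          (fun U => Real.exp (((2 : ℕ) : ℝ) * ∑ i ∈ T, Q β R (q i) (x i) U)) ≤ Real.exp (B_Q * T.card)) :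
    ResponseMomentsDefs.ResponseMomentsOdd6SU2 := by
  obtain ⟨B, hB⟩ := responseMoments_of_quadratic_levelZero 2 a Q MQ hQm hQb 𝔟 ε hε₀ hε hβ₁ hsplit hEMQ
  exact ⟨a, c, C₁, B, β₁, ℓ₁, P₀, p, hc, hwin, hℓ₁, hC₁, hp, hB⟩

end Named

end Summit.QuantumFields.YangMills.Cruxes.UVSeamRec.PolymerData

end
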